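import Literature.MathematicalPhysics.QuantumFieldTheory.Balaban1983to89.Node00.DressedSlotsOfRecord12
import Literature.MathematicalPhysics.QuantumFieldTheory.Balaban1983to89.B16RLeafRecord12AtLive
import Summits.QuantumFields.YangMills.Theorems.BalabanUVNodesN19MGFFormKernelChainRStep

/-!
# BalabanUVNodes ∕ N19 — the MGF road at the LIVE selector of record, I: def-T's slot recursion is 1-homogeneous in its start, so the live selector of record
# IS the live selector of F3's own VACUUM pre-𝐑 family, whose moved sequences are therefore dead (B16RLeaf's «not live ⇒ dead», transported to F3's tower)

Cell `pub-ymgap` (HUMAN RULING D-0062, Track A), node N19 = NE7, R134 seat `pub-ymgap-dag-n19-c` (g6); the FOURTH disjoint piece of dag-lead's REBALANCE №65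
(WORDS-132 (2): «OFFER-21 PLACED WITH n19-c»; dag-n19-d g6 YIELD-21 ACK l.16005) of lens `ym-lens-BalabanUVNodes-decomp` v5 ROW MF-ID (`LENS-decomp.md`
07acd831aa830b9f §v5.4 V42 ∕ §v5.3 M20 (k2)): the at-record module (dag-n19-d, `…N19MGFKernelTower` ∕ `…N19MGFFormAtRecord`) types `MGFForm` at the IDENTITY
selector `ppSelIdOfRecord`; the K0′∕K0‴ witness of record is RE-PINNED at the LIVE selector `ppSelLiveOfRecord` (K0a `Node00/Record12LiveSelector`, director-ym
LINE №114 (α)); this file and its sibling `…N19MGFRoadLiveSelectorRStep.lean` supply what the extension `…_of_ppSelLive` needs.  The lens's V42 («a non-live sequence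
has identically vanishing own fibre integral») is ALREADY IN THE TREE — `B16RLeafRecord12Live.fibreIntegral_rterm_eq_zero_of_not_live` ∕
`B16RLeafRecord12AtLive.dead_of_not_liveSeq` ∕ `dead_of_liveSelOfSlot_ne` (the N13∕N11 𝐑-leaf seat) — and is CITED here, not restated.  Filed `--supports` K3‴
«SpineGivenEndpointR13» (stmt-QuantumFields-19912) `--as helper`.  COUNT-NEUTRAL.  THEOREMS ONLY (0 `def`); imports two `Literature/` modules + dag-n19-e g7's generic MF-R module
`Thm/BalabanUVNodesN19MGFFormKernelChainRStep.lean` (p490454 + v1.1: `lmarginal_ofReal_mul_const`, `lmarginal_ofReal_const_sandwich` consumed BY NAME); no Theses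
import; general `N`; edits nothing.

WHAT IS PROVED ([folklore] ∕ bookkeeping throughout; def-R's `rstepSlot` ∕ `rratio` ∕ `fibOfSeq`, def-T's `tstepOfRecord` ∕ `texpAOfRecordFrom`, F3's
`dressedSlotsOfDatum₉` (dag-n20-e ∕ n20-d), K0a's `LiveSeq` ∕ `liveSelOfSlot` ∕ `ppSelLiveOfRecord` — all cited BY NAME, nothing restated).
* §1 b01's real fibre integral `∫dV⌈_{Z′} = toReal ∘ lmarginal ∘ ofReal`, the `toReal` faces of dag-n19-e's unconditional `ℝ≥0∞` facts: a nonnegative constant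
  pulls out (`fibreIntegral_const_mul`, NO measurability), and ★ the two-sided comparison `m·∫⌈f ≤ ∫⌈f′ ≤ M·∫⌈f` from a POINTWISE sandwich `m·f ≤ f′ ≤ M·f`, `0 < m`,
  with NO measurability and NO bound (`fibreIntegral_sandwich_of_pointwise`; with `0 < m` the junk value `toReal ∞ = 0` is hit by both sides at once — dag-n19-e's
  `fibreIntegral_const_sandwich` is the measurable-and-bounded case, `fibreIntegral_eq_zero_iff_of_sandwich` the zero-set case; the T-stepped slots of record carry
  no pointwise bound on `avgDensity`, whence this INEQUALITY form).
* §2 bridge: «the identity-selector R-stepped slot vanishes identically» (K0a's `¬ LiveSeq` in def-R's currency) ⇒ B16RLeaf's «not live» ⇒ dead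
  (`not_live_of_rstepOfSel_id_null`, `fibreIntegral_rterm_eq_zero_of_rstepOfSel_id_null` — one call of `fibreIntegral_rterm_eq_zero_of_not_live`).
* §3 HOMOGENEITY: the T-step (†) is linear in the slot (`tstepOfRecord_const_mul`, `integral_const_mul` — no integrability), the R-step is 1-homogeneous at ANY
  selector (`rstepSlot_const_mul`: numerator and denominator of every (0.3) ratio scale alike, `0 < c`), hence def-T's recursion is 1-homogeneous in its START
  at fixed run and couplings (`texpAOfRecordFrom_const_mul_start`), liveness is scale-free (`liveSeq_const_mul_iff`) and so is the live selector
  (`liveSelOfSlot_const_mul` — it reads `f` only through `LiveSeq f`).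
* §4 ★ AT F3: for ANY datum `D`, loop string, normalisation `E`, run `p` and couplings `g` with `g 0 = g₀ p.K` (true at a spine reading `p = ⟨K₀+K, m, g₀(K₀+K)⟩`),
  the record's post-𝐑 tower `slotsOfRecord … E (wOfRecord₉ ϑ) ϑ.ppSel p g` (start `ρ₀ = e^{−E p}·e^{−A∕g₀²}`) IS `e^{−E p}`× F3's VACUUM (`t = 0`) dressed tower
  `dressedSlotsOfDatum₉ ϑ D g₀ os 0 p g` level by level (`slotsOfRecord_eq_exp_mul_dressedSlotsOfDatum₉_zero`, from F3's `rhoZeroOfRecord_eq_mul_dressedStart_zero`);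
  hence for a tuple PINNED AT THE LIVE SELECTOR OF RECORD (`ϑ.ppSel = ppSelLiveOfRecord E (wOfRecord₉ ϑ)`) the selector of record at level `k+1` IS the live
  selector of F3's own vacuum pre-𝐑 family `tstepOfRecord … (dressedSlotsOfDatum₉ ϑ D g₀ os 0 p g k)` (`ppSelLiveOfRecord_succ_eq_liveSelOfSlot_dressed_zero`), and
  every sequence it MOVES has null vacuum own fibre integral (`fibreIntegral_vacuum_preR_eq_zero_of_ppSel_ne`, B16RLeaf's `dead_of_not_liveSeq` transported;
  INSTANCE-GENERIC per def-R TS-8: the displayed fibre integral takes its `DecidableEq (PBond …)` instance as a binder, bridged by `Subsingleton.elim`) — the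
  degenerate-selector hypothesis of the sibling's R-step faces, DISCHARGED.  (dag-n19-d INTENT-18 (iv): «the live selector needs `g 0 = g₀ p.K`» — this is where
  it enters, and only here.)

HONEST FRAMING.  Finite-sum ∕ `lmarginal` bookkeeping about def-R's and def-T's OBJECTS; no estimate; nothing of Bałaban's instantiated ([Balaban1989LargeFieldI]
(0.3) p. 176 ∕ p. 177, [Balaban1988Convergent] (2.18), (3.24) are cited for the SHAPE of the objects only); `MGFForm` at the live selector is NOT typed here (that
is dag-n19-d's `…_of_ppSelLive`, consuming this); NE7 ∕ NE1′ NOT proved; N19 NOT discharged (0∕1); K3‴ NOT claimed; counts UNMOVED (typed 28∕28 · discharged 5∕27 ·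
A 5∕28); one finite four-torus programme — NOT ℝ⁴, NOT OS, NOT a mass gap, NOT Clay.  0 `def`; 0 `sorry`; standard axioms.
-/

set_option autoImplicit false

noncomputable section

open MeasureTheory
open scoped BigOperators ENNReal

namespace Summit.QuantumFields.YangMills.BalabanUVNodes.N19MGFRoadLiveSelector

open Literature.MathematicalPhysics.QuantumFieldTheory.Balaban1983to89
open Literature.MathematicalPhysics.QuantumFieldTheory.Balaban1983to89.Node00
open Literature.MathematicalPhysics.QuantumFieldTheory.Balaban1983to89.B15.BasicStep (fibreIntegral)
open Literature.MathematicalPhysics.QuantumFieldTheory.Balaban1983to89.B16RLeafRecord12Live (fibreIntegral_rterm_eq_zero_of_not_live)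
open Literature.MathematicalPhysics.QuantumFieldTheory.Balaban1983to89.B16RLeafRecord12AtLive (not_liveSeq_of_liveSelOfSlot_ne dead_of_not_liveSeq)
open Summit.QuantumFields.YangMills.BalabanUVNodes.N19MGFFormKernelChainRStep (lmarginal_ofReal_mul_const lmarginal_ofReal_const_sandwich)
open T4Continuum

/-! ## §1 Two `toReal` faces of dag-n19-e's unconditional `lmarginal` facts: b01's real fibre integral `∫dV⌈_{Z′}` (no measurability, no bound) -/

section Fibre

variable {P : Params} {G : Type*} [GaugeGroup G] [MeasurableSpace G] [HaarData G] {j : ℕ}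

/-- A nonnegative CONSTANT pulls out of the real fibre integral: `∫⌈(c·f) = c·∫⌈f` (`0 ≤ c`; NO measurability — the `toReal` face of dag-n19-e's
`N19MGFFormKernelChainRStep.lmarginal_ofReal_mul_const`). [cite: Balaban1989LargeFieldI, (0.3) p.176 (bookkeeping)] -/
theorem fibreIntegral_const_mul {iP : DecidableEq (PBond P j)} (s : Finset (PBond P j)) {c : ℝ} (hc : 0 ≤ c) (f : Density P j G)
    (V : GaugeField P j G) :
    @fibreIntegral P j G _ _ _ iP s (fun U => c * f U) V = c * @fibreIntegral P j G _ _ _ iP s f V := by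
  simp only [fibreIntegral, show ∀ U, c * f U = f U * c from fun U => mul_comm _ _]
  rw [lmarginal_ofReal_mul_const iP s f hc V, ENNReal.toReal_mul, ENNReal.toReal_ofReal hc]

/-- **TWO-SIDED COMPARISON OF FIBRE INTEGRALS FROM A POINTWISE SANDWICH — NO MEASURABILITY, NO BOUND**: `m·f ≤ f′ ≤ M·f` pointwise with `0 < m`,
`0 ≤ M` ⇒ `m·∫⌈f ≤ ∫⌈f′ ≤ M·∫⌈f` on every fibre — the `toReal` face of dag-n19-e's unconditional `ℝ≥0∞` sandwich `lmarginal_ofReal_const_sandwich`: with `0 < m` the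
junk value `toReal ∞ = 0` is hit by BOTH sides at once (their `fibreIntegral_const_sandwich` is the measurable-and-bounded case, `fibreIntegral_eq_zero_iff_of_sandwich`
the zero-set case; the T-stepped slots of record carry no pointwise bound on `avgDensity`, whence this INEQUALITY form). [folklore] -/
theorem fibreIntegral_sandwich_of_pointwise {iP : DecidableEq (PBond P j)} (s : Finset (PBond P j)) {f f' : Density P j G}
    {m M : ℝ} (hm : 0 < m) (hM : 0 ≤ M) (hlo : ∀ U, m * f U ≤ f' U) (hhi : ∀ U, f' U ≤ M * f U) (V : GaugeField P j G) :
    m * @fibreIntegral P j G _ _ _ iP s f V ≤ @fibreIntegral P j G _ _ _ iP s f' V ∧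
      @fibreIntegral P j G _ _ _ iP s f' V ≤ M * @fibreIntegral P j G _ _ _ iP s f V := by
  obtain ⟨l1, l2⟩ := lmarginal_ofReal_const_sandwich iP s hm.le hM hlo hhi V
  set Lf := (∫⋯∫⁻_s, (fun U => ENNReal.ofReal (f U)) ∂(fun _ : PBond P j => (HaarData.haar : Measure G))) V with hLf
  set Lf' := (∫⋯∫⁻_s, (fun U => ENNReal.ofReal (f' U)) ∂(fun _ : PBond P j => (HaarData.haar : Measure G))) V with hLf'
  have hm' : ENNReal.ofReal m ≠ 0 := by simpa using hm
  show m * Lf.toReal ≤ Lf'.toReal ∧ Lf'.toReal ≤ M * Lf.toReal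
  by_cases htop : Lf = ∞
  · -- both sides hit the junk value `toReal ∞ = 0`
    have htop' : Lf' = ∞ := eq_top_iff.mpr (le_trans (by rw [htop, ENNReal.mul_top hm']) l1)
    rw [htop, htop', ENNReal.toReal_top, mul_zero, mul_zero]
    exact ⟨le_rfl, le_rfl⟩
  · have hMtop : ENNReal.ofReal M * Lf ≠ ∞ := ENNReal.mul_ne_top ENNReal.ofReal_ne_top htop
    have htop' : Lf' ≠ ∞ := ne_top_of_le_ne_top hMtop l2
    refine ⟨?_, ?_⟩
    · calc m * Lf.toReal = (ENNReal.ofReal m * Lf).toReal := by rw [ENNReal.toReal_mul, ENNReal.toReal_ofReal hm.le]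
        _ ≤ Lf'.toReal := ENNReal.toReal_mono htop' l1
    · calc Lf'.toReal ≤ (ENNReal.ofReal M * Lf).toReal := ENNReal.toReal_mono hMtop l2
        _ = M * Lf.toReal := by rw [ENNReal.toReal_mul, ENNReal.toReal_ofReal hM]

end Fibre

/-! ## §2 K0a's «non-live» in def-R's currency is B16RLeaf's «not live ⇒ dead» hypothesis (the lens's V42 is IN THE TREE:
`B16RLeafRecord12Live.fibreIntegral_rterm_eq_zero_of_not_live`, `B16RLeafRecord12AtLive.dead_of_not_liveSeq` — cited, not restated) -/

section NonLive

variable {P : Params} {G : Type*} [GaugeGroup G] [MeasurableSpace G] [HaarData G] {j : ℕ}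

/-- Bridge (generic over def-R's `Step.Repr218`): if the identity-selector R-stepped slot `(𝐓e^A)(a)·∫⌈t_a∕∫⌈t_a` vanishes at EVERY configuration, then `a` is
«not live» in B16RLeaf's sense (no configuration with slot and own fibre integral both non-zero) — so `B16RLeafRecord12Live.fibreIntegral_rterm_eq_zero_of_not_live`
gives `∫⌈_{fib a} t_a ≡ 0`. [cite: Balaban1989LargeFieldI, (0.3) p.176 (bookkeeping)] -/
theorem not_live_of_rstepOfSel_id_null (iP : DecidableEq (PBond P j)) (r : Step.Repr218 P G j) (fib : r.Adm → Finset (PBond P j)) {a : r.Adm}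
    (hnull : ∀ V, (rstepOfSel r id fib).TexpA a V = 0) :
    ¬ ∃ V, r.TexpA a V ≠ 0 ∧ fibreIntegral (fib a) (rterm r a) V ≠ 0 := by
  classical
  rintro ⟨V, hT, hI⟩
  have h := hnull V
  rw [rstepOfSel_TexpA] at h
  have hS : Finset.univ.filter (fun b : r.Adm => id b = a) = {a} := by
    ext b; simp only [Finset.mem_filter, Finset.mem_univ, true_and, id_eq, Finset.mem_singleton]
  rw [hS, Finset.sum_singleton, rratio, div_self hI, mul_one] at h
  exact hT h

/-- … hence its own fibre integral vanishes identically (B16RLeaf's fibre-constancy lemma, by name). [cite: Balaban1989LargeFieldI, (0.3) p.176 (bookkeeping)] -/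
theorem fibreIntegral_rterm_eq_zero_of_rstepOfSel_id_null (iP : DecidableEq (PBond P j)) (r : Step.Repr218 P G j)
    (fib : r.Adm → Finset (PBond P j)) {a : r.Adm} (hnull : ∀ V, (rstepOfSel r id fib).TexpA a V = 0) (V : GaugeField P j G) :
    fibreIntegral (fib a) (rterm r a) V = 0 :=
  fibreIntegral_rterm_eq_zero_of_not_live r fib a (not_live_of_rstepOfSel_id_null iP r fib hnull) V

end NonLive

/-! ## §3 (L2) Homogeneity of def-T's slot recursion in its start (T-step linear, R-ratios scale-free), and the live selector under scaling -/

section Homogeneity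

variable (F : T4Family) (N : ℕ) [NeZero N] (ν : Stage7Numerics)

/-- **THE T-STEP (†) IS LINEAR IN THE SLOT**: scaling every level-k slot by a constant `c` scales the T-stepped slot by `c` (the Bochner integral against the
averaging kernel is homogeneous, `integral_const_mul`; no integrability needed). [cite: Balaban1988Convergent, (3.1) p.264, (3.24)–(3.25) p.270 (bookkeeping)] -/
theorem tstepOfRecord_const_mul (M : ℕ) (w : StepWeightsOfRecord F N ν M) (p : B12.RunParams) (g : ℕ → ℝ) (k : ℕ) (c : ℝ)
    (T : SeqOfRecord F ν M g p.K k → Density (F.P p.K) k (SU N)) (s' : SeqOfRecord F ν M g p.K (k + 1))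
    (V' : GaugeField (F.P p.K) (k + 1) (SU N)) :
    tstepOfRecord F N ν M w p g k (fun s U => c * T s U) s' V' = c * tstepOfRecord F N ν M w p g k T s' V' := by
  show texpASucc _ _ _ _ s' V' = c * texpASucc _ _ _ _ s' V'
  rw [texpASucc_apply, texpASucc_apply]
  have h : (fun U => w p g k s' U V' * (chiSeqOfRecord F N ν M g p.K k s'.init U * (c * T s'.init U)))
      = fun U => c * (w p g k s' U V' * (chiSeqOfRecord F N ν M g p.K k s'.init U * T s'.init U)) := funext fun U => by ring
  rw [h, integral_const_mul]
  ring

variable (τ : TowerNumerics)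

/-- **THE R-STEP IS 1-HOMOGENEOUS IN THE SLOT, ANY SELECTOR**: scaling every slot by a POSITIVE constant `c` scales every (0.3) ratio's numerator and
denominator alike (`∫⌈(χ·c·f) = c·∫⌈(χ·f)`), so the R-stepped slot scales by `c`. [cite: Balaban1989LargeFieldI, (0.3) p.176 (bookkeeping)] -/
theorem rstepSlot_const_mul (p : B12.RunParams) (g : ℕ → ℝ) (k : ℕ)
    (sel : SeqOfRecord F ν τ.M g p.K k → SeqOfRecord F ν τ.M g p.K k) {c : ℝ} (hc : 0 < c) (f : TexpASlot F N ν τ.M p g k)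
    (s : SeqOfRecord F ν τ.M g p.K k) (V : GaugeField (F.P p.K) k (SU N)) :
    rstepSlot F N ν τ p g k sel (fun s U => c * f s U) s V = c * rstepSlot F N ν τ p g k sel f s V := by
  unfold rstepSlot rstepOfSel
  dsimp only
  simp only [show (sliceOfRecord F N ν τ.M p g k fun s U => c * f s U).TexpA s V = c * f s V from rfl,
    show (sliceOfRecord F N ν τ.M p g k f).TexpA s V = f s V from rfl]
  rw [mul_assoc]
  congr 1
  refine congrArg _ (Finset.sum_congr rfl fun a _ => ?_)
  unfold rratio
  have hrt : ∀ b : SeqOfRecord F ν τ.M g p.K k, rterm (sliceOfRecord F N ν τ.M p g k (fun s U => c * f s U)) b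
      = fun U => c * rterm (sliceOfRecord F N ν τ.M p g k f) b U := fun b => funext fun U => by
    show chiSeqOfRecord F N ν τ.M g p.K k b U * (c * f b U) = c * (chiSeqOfRecord F N ν τ.M g p.K k b U * f b U)
    ring
  rw [hrt a, hrt s, fibreIntegral_const_mul _ hc.le, fibreIntegral_const_mul _ hc.le, mul_div_mul_left _ _ hc.ne']

/-- **def-T's SLOT RECURSION IS 1-HOMOGENEOUS IN ITS START** (at fixed run `p` and couplings `g`; any step weights, ANY selector): if `start₁ p g = c·start₂ p g`
with `0 < c`, every slot of the tower from `start₁` is `c` times the slot of the tower from `start₂` — level by level (`texpAOfRecordFrom_succ`,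
`tstepOfRecord_const_mul`, `rstepSlot_const_mul`). [cite: Balaban1988Convergent, (2.18) p.257, (3.24) p.270; Balaban1989LargeFieldI, (0.3) p.176 (bookkeeping)] -/
theorem texpAOfRecordFrom_const_mul_start (start₁ start₂ : (p : B12.RunParams) → (ℕ → ℝ) → Density (F.P p.K) 0 (SU N))
    (w : StepWeightsOfRecord F N ν τ.M) (ppSel : PpSelOfRecord F ν τ.M) (p : B12.RunParams) (g : ℕ → ℝ) {c : ℝ} (hc : 0 < c)
    (hstart : ∀ U, start₁ p g U = c * start₂ p g U) :
    ∀ (k : ℕ) (s : SeqOfRecord F ν τ.M g p.K k) (V : GaugeField (F.P p.K) k (SU N)),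
      texpAOfRecordFrom F N ν τ.M start₁ w (rstepSlotOfRecord F N ν τ ppSel) p g k s V
        = c * texpAOfRecordFrom F N ν τ.M start₂ w (rstepSlotOfRecord F N ν τ ppSel) p g k s V := by
  intro k
  induction k with
  | zero => intro s V; exact hstart V
  | succ k ih =>
    intro s V
    rw [texpAOfRecordFrom_succ, texpAOfRecordFrom_succ]
    have hT : tstepOfRecord F N ν τ.M w p g k (texpAOfRecordFrom F N ν τ.M start₁ w (rstepSlotOfRecord F N ν τ ppSel) p g k)
        = fun s U => c * tstepOfRecord F N ν τ.M w p g k (texpAOfRecordFrom F N ν τ.M start₂ w (rstepSlotOfRecord F N ν τ ppSel) p g k) s U := by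
      funext s' V'
      rw [← tstepOfRecord_const_mul]
      congr 1
      funext s'' U
      exact ih s'' U
    rw [hT]
    exact rstepSlot_const_mul F N ν τ p g (k + 1) (ppSel p g (k + 1)) hc _ s V

variable {F N ν τ} {p : B12.RunParams} {g : ℕ → ℝ} {k : ℕ}

/-- **LIVENESS IS SCALE-FREE**: a sequence is live for `c·f` iff it is live for `f` (`0 < c`). [cite: Balaban1989LargeFieldI, (0.3) p.176 (bookkeeping)] -/
theorem liveSeq_const_mul_iff {c : ℝ} (hc : 0 < c) (f : TexpASlot F N ν τ.M p g k) (s : SeqOfRecord F ν τ.M g p.K k) :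
    LiveSeq F N ν τ p g k (fun s U => c * f s U) s ↔ LiveSeq F N ν τ p g k f s := by
  unfold LiveSeq
  refine exists_congr fun V => ?_
  rw [rstepSlot_const_mul F N ν τ p g k id hc f s V, mul_ne_zero_iff, and_iff_right hc.ne']

/-- **THE LIVE SELECTOR IS SCALE-FREE**: `liveSelOfSlot (c·f) = liveSelOfSlot f` (`0 < c`) — the selector reads `f` only through the predicate `LiveSeq f`.
[cite: Balaban1989LargeFieldI, (0.3) p.176 and p.177 (bookkeeping)] -/
theorem liveSelOfSlot_const_mul {c : ℝ} (hc : 0 < c) (f : TexpASlot F N ν τ.M p g k) :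
    liveSelOfSlot F N ν τ p g k (fun s U => c * f s U) = liveSelOfSlot F N ν τ p g k f := by
  have key : LiveSeq F N ν τ p g k (fun s U => c * f s U) = LiveSeq F N ν τ p g k f :=
    funext fun s => propext (liveSeq_const_mul_iff hc f s)
  unfold liveSelOfSlot
  rw [key]

end Homogeneity

/-! ## §4 F3's `t = 0` tower IS the record's `ρ₀`-tower up to `e^{E}`, so the live selector of record is the live selector of F3's own vacuum pre-𝐑 family -/

section AtF3

variable (F : T4Family) (N : ℕ) [NeZero N]

/-- **F3's VACUUM TOWER = THE RECORD's TOWER × `e^{E p}`.**  At a Stage-9 tuple `ϑ`, ANY datum `D`, loop string `os`, a run `p` and couplings `g` whose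
bare value is the run's (`g 0 = g₀ p.K`), and ANY normalisation `E`: the record's post-𝐑 slot family `slotsOfRecord … E (wOfRecord₉ ϑ) ϑ.ppSel p g k`
(start `ρ₀ = e^{−E p}·e^{−A∕g₀²}`) is `e^{−E p}` times F3's `t = 0` dressed slot family `dressedSlotsOfDatum₉ ϑ D g₀ os 0 p g k` (start `e^{0·F}·e^{−A∕g₀²}`), at
every level — §3's homogeneity on F3's `rhoZeroOfRecord_eq_mul_dressedStart_zero`. [cite: Balaban1988Convergent, Thm 1 p.262, (2.18) p.257; King1986, (3.10) p.656 (bookkeeping)] -/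
theorem slotsOfRecord_eq_exp_mul_dressedSlotsOfDatum₉_zero (ϑ : Stage9Params F N) (D : FiniteEpsData F (SU N)) (g₀ : ℕ → ℝ) (os : List (ULoop F))
    (E : B12.RunParams → ℝ) (p : B12.RunParams) (g : ℕ → ℝ) (hg : g 0 = g₀ p.K) (k : ℕ) (s : SeqOfRecord F ϑ.ν ϑ.τ9.M g p.K k)
    (V : GaugeField (F.P p.K) k (SU N)) :
    slotsOfRecord F N ϑ.ν ϑ.τ9 E (wOfRecord₉ F N ϑ) ϑ.ppSel p g k s V = Real.exp (-E p) * dressedSlotsOfDatum₉ F N ϑ D g₀ os 0 p g k s V := by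
  unfold slotsOfRecord dressedSlotsOfDatum₉
  rw [← texpAOfRecordFrom_rhoZero]
  refine texpAOfRecordFrom_const_mul_start F N ϑ.ν ϑ.τ9 _ _ (wOfRecord₉ F N ϑ) ϑ.ppSel p g (Real.exp_pos _) (fun U => ?_) k s V
  show rhoZeroOfRecord F N p.K (g 0) (E p) U = Real.exp (-E p) * dressedStart F N D g₀ os 0 p U
  rw [hg]
  exact rhoZeroOfRecord_eq_mul_dressedStart_zero F N D g₀ os p (E p) U

/-- **THE LIVE SELECTOR OF RECORD, READ ON F3's OWN VACUUM PRE-𝐑 FAMILY.**  For a tuple `ϑ` PINNED AT THE LIVE SELECTOR OF RECORD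
(`ϑ.ppSel = ppSelLiveOfRecord E (wOfRecord₉ ϑ)` — K0a's re-pin, e.g. `theta12LiveOfRecord`), any datum, `g 0 = g₀ p.K`: at every positive level the selector
of record IS the live selector of F3's `t = 0` pre-𝐑 family `tstepOfRecord … (dressedSlotsOfDatum₉ ϑ D g₀ os 0 p g k)` (scale-freeness of §3 on
`e^{−E p}`). [cite: Balaban1989LargeFieldI, (0.3) p.176 and p.177; Balaban1988Convergent, (3.22)–(3.24) pp.269–270 (bookkeeping)] -/
theorem ppSelLiveOfRecord_succ_eq_liveSelOfSlot_dressed_zero (ϑ : Stage9Params F N) (E : B12.RunParams → ℝ)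
    (hsel : ϑ.ppSel = ppSelLiveOfRecord F N ϑ.ν ϑ.τ9 E (wOfRecord₉ F N ϑ)) (D : FiniteEpsData F (SU N)) (g₀ : ℕ → ℝ) (os : List (ULoop F))
    (p : B12.RunParams) (g : ℕ → ℝ) (hg : g 0 = g₀ p.K) (k : ℕ) :
    ppSelLiveOfRecord F N ϑ.ν ϑ.τ9 E (wOfRecord₉ F N ϑ) p g (k + 1)
      = liveSelOfSlot F N ϑ.ν ϑ.τ9 p g (k + 1)
          (tstepOfRecord F N ϑ.ν ϑ.τ9.M (wOfRecord₉ F N ϑ) p g k (dressedSlotsOfDatum₉ F N ϑ D g₀ os 0 p g k)) := by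
  rw [ppSelLiveOfRecord_succ, ← slotsOfRecord_ppSelLive, ← hsel]
  have hT : tstepOfRecord F N ϑ.ν ϑ.τ9.M (wOfRecord₉ F N ϑ) p g k (slotsOfRecord F N ϑ.ν ϑ.τ9 E (wOfRecord₉ F N ϑ) ϑ.ppSel p g k)
      = fun s U => Real.exp (-E p) *
          tstepOfRecord F N ϑ.ν ϑ.τ9.M (wOfRecord₉ F N ϑ) p g k (dressedSlotsOfDatum₉ F N ϑ D g₀ os 0 p g k) s U := by
    funext s' V'
    rw [← tstepOfRecord_const_mul]
    congr 1
    funext s'' U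
    exact slotsOfRecord_eq_exp_mul_dressedSlotsOfDatum₉_zero F N ϑ D g₀ os E p g hg k s'' U
  rw [hT]
  exact liveSelOfSlot_const_mul (Real.exp_pos _) _

/-- **THE DEGENERATE-SELECTOR HYPOTHESIS OF THE MGF ROAD, DISCHARGED AT THE LIVE SELECTOR OF RECORD**: for `ϑ` pinned at the live selector of
record, any datum, `g 0 = g₀ p.K`, every positive level `k + 1` and every sequence `s` the selector of record MOVES (`ϑ.ppSel p g (k+1) s ≠ s`), the own
fibre integral of F3's VACUUM pre-𝐑 term vanishes identically: `∫⌈_{Z′(s)} χ_{k+1}(s)·(𝐓 slot⁰_k)(s) ≡ 0` — so the R-step moves NO vacuum mass, and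
(by two-sided domination, the companion at-record module) no dressed mass either. [cite: Balaban1989LargeFieldI, (0.3) p.176 and p.177 (bookkeeping)] -/
theorem fibreIntegral_vacuum_preR_eq_zero_of_ppSel_ne (ϑ : Stage9Params F N) (E : B12.RunParams → ℝ)
    (hsel : ϑ.ppSel = ppSelLiveOfRecord F N ϑ.ν ϑ.τ9 E (wOfRecord₉ F N ϑ)) (D : FiniteEpsData F (SU N)) (g₀ : ℕ → ℝ) (os : List (ULoop F))
    (p : B12.RunParams) (g : ℕ → ℝ) (hg : g 0 = g₀ p.K) (k : ℕ) {s : SeqOfRecord F ϑ.ν ϑ.τ9.M g p.K (k + 1)}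
    (hs : ϑ.ppSel p g (k + 1) s ≠ s) (iP : DecidableEq (PBond (F.P p.K) (k + 1))) (V : GaugeField (F.P p.K) (k + 1) (SU N)) :
    @fibreIntegral _ _ _ _ _ _ iP (fibOfSeq F ϑ.ν ϑ.τ9 p g (k + 1) s)
      (rterm (sliceOfRecord F N ϑ.ν ϑ.τ9.M p g (k + 1)
        (tstepOfRecord F N ϑ.ν ϑ.τ9.M (wOfRecord₉ F N ϑ) p g k (dressedSlotsOfDatum₉ F N ϑ D g₀ os 0 p g k))) s) V = 0 := by
  have hs' : liveSelOfSlot F N ϑ.ν ϑ.τ9 p g (k + 1)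
      (tstepOfRecord F N ϑ.ν ϑ.τ9.M (wOfRecord₉ F N ϑ) p g k (dressedSlotsOfDatum₉ F N ϑ D g₀ os 0 p g k)) s ≠ s := by
    rw [← ppSelLiveOfRecord_succ_eq_liveSelOfSlot_dressed_zero F N ϑ E hsel D g₀ os p g hg k]
    rw [hsel] at hs
    exact hs
  -- B16RLeaf's «moved ⇒ dead» at THEIR instance, bridged to the consumer's `iP` by `Subsingleton.elim` (TS-8)
  have h := dead_of_not_liveSeq _ (not_liveSeq_of_liveSelOfSlot_ne _ hs') V
  convert h using 2

end AtF3

end Summit.QuantumFields.YangMills.BalabanUVNodes.N19MGFRoadLiveSelector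

end
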